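import Literature.MathematicalPhysics.QuantumFieldTheory.Balaban1983to89.B16Ineq197
import Literature.MathematicalPhysics.QuantumFieldTheory.Balaban1983to89.B14RelTreeLength
import Literature.MathematicalPhysics.QuantumFieldTheory.Balaban1983to89.B16MergeGeometry

/-!
# `Balaban1983to89.B16Ineq197RelGlue` (v1) — the leaf `Subadd193` (the RELATIVE TREE GLUING behind (1.93) of
[Balaban1989LargeFieldII] p. 388) of the cell's typed (1.91) ⇒ (1.97) bookkeeping `…B16Ineq197.Polymer`, DISCHARGED in
unit pv22's continuum model `…TreeLength` (unit cubes of ℤ^d, polygonal graphs, `carrier`, `len`, `Admissible`, `treeLen`)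
with unit b01's relative size `…B14.RelTreeLength.RAdmissible` / `relTreeLen` ((1.67) p. 376) and this lineage's touching
relation `…B16MergeGeometry.Touch` / `touchGraph` (gen 9, p. 386 *"intersect, or touch each other"*) BY NAME: relative joins
through a common met cube (cost ≤ 1) and through a touching pair of met cubes (cost ≤ 2), a gluing induction over an abstract
CONTACT structure whose cut condition (connectivity of the contact graph; supplied e.g. by `Step.Budget.GConn (touchGraph ·)`)
is a NAMED HYPOTHESIS, passage to infima, and the instance `subadd193_of_relGlue : … → P.Subadd193 K` with junction cost
`cJ ≥ 2` and `treeX ≥ treeLen + 2`; window corollary on b01's concrete carrier; a two-cube non-vacuity witness.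

CITATION HEADER (lean-in-tree rule 2026-08-18).  Source under audit (cell paper B16): T. Bałaban, *Large field
renormalization. II. Localization, exponentiation, and bounds for the 𝐑 operation*, Commun. Math. Phys. **122**, 355–392
(1989) [Balaban1989LargeFieldII] (held `paper:balaban1989-cmp122-large-field-ii`; journal page = PDF page + 354); every
quotation below is read from the page renders `…1989-cmp122-large-field-II-p022/p023/p033/p034-x2.png` (pp. 376, 377, 387,
388) READ AS IMAGES by the typing unit (this lineage, gens 14–16).  Printed, p. 376 [PDF 22], (1.67), verbatim: *"d_{k,Z}(Y) =
M⁻¹ (the length of a shortest tree graph contained in Y and intersecting all M-cubes of the components of Y∖Z)"*; p. 377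
[PDF 23]: *"the intersection Y∩Z~ is a union of components of Z~, containing at least one component"*, (1.68) *"for Y∖Z~ ≠
∅"*; p. 387 [PDF 33]: *"Each term determines the localization domain X′₀ = ∪_{Y∈𝐃} Y ∪ ∪_{j=1}^n X_j"*; p. 388 [PDF 34], after
(1.91): *"Here the summation is over {X_{j_1},…,X_{j_q}} and 𝐃 such that the connected localization domain they determine is
equal to X′"*, after (1.92): *"where Z′ = ∪_{i=1}^m Y_i ∪ ∪_{h=1}^q X_{j_h}"*, display (1.93): *"Π_{Y∈𝐃} α exp(−(1+2β)κ
d_{k,Z′}(Y)) ≦ exp(−(1+β)κ d_{k,∪Y_i}(X′)) exp(−(3·2^d)⁻¹βκM^{−d}|X′∖∪Y_i|) · Π_{h=1}^q exp((1 + β + (3·2^d)⁻¹β)κM^{−d}|X_{j_h}|)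
Π_{Y∈𝐃} α^{2/3} exp(−½βκ d_{k,Z′}(Y)), (1.93)"* and the sentence after it: *"where we have used the fact that α is
sufficiently small, e.g., α^{1/3} ≦ exp(−(1+β)κ2d), to produce the exponential factors connecting graphs in domains Y, in the
cases they intersect outside Z′."*  The gluing MECHANISM is the one of [Balaban1988RG2Cluster] (T. Bałaban, *Renormalization
group approach to lattice gauge field theories. II*, Commun. Math. Phys. **116** (1988)) p. 18, (2.27), verbatim (as quoted
and PROVED for `treeLen` in pv22's `TreeLength.treeLen_biUnion_add_two_le`): *"Because ⋃_{Y∈𝐃} Y = Y₀ and Y₀ is a connected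
domain, hence the definition of d_k(Y) implies the inequality"* — here in the RELATIVE setting of (1.67) (graphs of Y need
only meet the cubes of Y∖Z).  The Bałaban papers are manuscripts UNDER ADJUDICATION by the audit cell `pub-balaban`: NOTHING
printed in them is asserted here.  In the cell's typed bookkeeping `…B16Ineq197` (unit b02, gen 14; tree v1.1) the step
*"exp(−(1+β)κ d_{k,∪Y_i}(X′))"* of (1.93) is the quoted LEAF `Polymer.Subadd193 : ∀ (S,𝐃) ∈ adm, dX ≤ Σ_{Y∈𝐃}(dY Y + cJ) +
Σ_{j∈S} treeX j` (dX = d_{k,∪Y_i}(X′), dY Y = d_{k,Z}(Y), cJ = the junction cost, treeX j = the tree cost of X_j with its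
entry connector; cell GAPS C-B16-7, C-adv6-51 (1)–(3)).  This module proves it in the continuum model under NAMED INCIDENCE
HYPOTHESES (binders; the cell's certified reading of pp. 377/387/388 — GAPS C-adv6-51 (1)–(3), C-adv7-85 (a) — is what makes
them hold in the intended model; it is QUOTED, NOT asserted): (i) `hcover` — every cube of X′ outside U (intended: U = the
cubes of ⋃Y_i ∩ X′, so dX = d_{k,∪Y_i}(X′) = `relTreeLen X′ (X′∖U)`) is a cube of some X_j, j ∈ S, or a cube OUTSIDE Z of
some Y ∈ 𝐃 (p. 387 *"X′₀ = ∪_{Y∈𝐃} Y ∪ ∪_{j=1}^n X_j"* with C-adv7-85 (a): Z ∩ X′ ⊆ Z′ ⊆ Z, every class-1 component inside X′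
being one of the X_{j_h}); (ii) `hcut` — the CUT CONDITION `CutLinked` of the contact structure "a required cube of one member
equals or is corner-adjacent to a required cube of another" on the members {X_j}_{j∈S} ⊔ 𝐃 (required cubes: all of X_j; the
cubes of Y∖Z): every non-empty proper subfamily is in contact with a member outside it — the typed form of *"the connected
localization domain they determine is equal to X′"* together with *"connecting graphs in domains Y, in the cases they
intersect outside Z′"* (C-adv6-51 (1)–(3): meeting members meet OUTSIDE Z′, where both graphs are required to pass; a Y meets
an X_{j_h} ⊆ Z′ through the collar cubes X~_{j_h}∖X_{j_h} ⊆ Y∖Z′, corner-adjacent to cubes of X_{j_h}); (iii) sizes as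
INEQUALITIES: `dX ≤ relTreeLen X′ (X′∖U)`, `relTreeLen Y (Y∖Z) ≤ dY Y`, `treeLen X_j + 2 ≤ treeX j`, `2 ≤ cJ`.  DIFFERENCE
FROM THE PRINT, recorded: the print's junction cost is 2d per connection (*"α^{1/3} ≦ exp(−(1+β)κ2d)"*); in the sup metric of
the model ([Dimock2013BalabanII] App. E convention, pv22 header) a junction through a common cube costs ≤ 1 and through a
touching pair ≤ 2, uniformly in d, so the typed clause `2 ≤ cJ` is WEAKER than the print's 2d (d ≥ 1); the entry connector
of an X_j is charged to `treeX` (≤ 2), as in `B16Ineq197`'s reading (cell S-B16.12).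

WHAT IS PROVED (no `sorry`, no new axioms; [folklore] = elementary): §1 `touch_of_cadj` / `touch_iff_eq_or_cadj` (b01's
corner adjacency `CAdj` versus the lineage's `Touch`: touching = equal or corner-adjacent), `rAdmissible_join_common` (+1),
`rAdmissible_join_touch` (+2, a common point of touching cubes by `B16MergeGeometry.Touch.exists_point`; the relative form of
`B16MergeGeometry.admissible_join_touch`), `rAdmissible_join_cadj`; §2 `Contact`, `touchGraph_adj_iff_contact`, `CutLinked`,
the sufficient conditions `cutLinked_of_chain` / `cutLinked_of_isRConnected` (chains of contacts,
`Literature.Probability.LatticeModels.IsRConnected`) / `cutLinked_of_gconn` (the cell's typed *"the graph G is connected"*,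
`Step.Budget.GConn (touchGraph S) I`, via `SimpleGraph.Walk.exists_boundary_dart`) / `cutLinked_of_pairwise`, the gluing
induction `exists_rAdmissible_glue`
and `exists_rAdmissible_biUnion` (graphs of the members glue to a relatively admissible graph for (⋃ D_i, ⋃ S_i) of length ≤ Σ
len + 2(#I − 1)); §3 `exists_rAdmissible_len_lt` (ε-near-optimal graphs), `relTreeLen_anti` (monotone: larger domain and fewer
required cubes give a smaller infimum), `relTreeLen_empty`, and the relative (2.27): `relTreeLen_biUnion_add_two_le` —
relTreeLen(⋃D_i, ⋃S_i) + 2 ≤ Σ_i (relTreeLen(D_i, S_i) + 2) under the cut condition; §4 the (1.93) instance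
`relTreeLen_le_glued193` (members indexed by `LF ⊕ DomY`, `Finset.disjSum`; X-members with S = D so `relTreeLen_self` =
`treeLen`) and **`subadd193_of_relGlue : … → P.Subadd193 K`**, the lane-(c) helper `treeLen_add_two_le_card_add_one`
(treeLen X_j + 2 ≤ #X_j + 1, pv22's `treeLen_le_card_sub_one`), and the WINDOW corollary `subadd193_window` on b01's concrete
carrier `B14.RelTreeLength.Window d` (dY = `Window.relSys.dRel` BY NAME, Y-graphs exist by b01's `exists_rAdmissible`); §5
non-vacuity `Toy.toy_subadd193` (two touching cubes of ℤ¹ as two Y-members, no X_j, Z = U = ∅: all binders inhabited,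
conclusion = the toy polymer's `Subadd193`).
WHAT IS *NOT* PROVED: the incidence hypotheses (i)–(ii) themselves (the lattice geometry of the 𝐑-operation carriers — the
component structure of P″_k Z, the collars X~_j ⊆ Y, pp. 377–388 — is not typed in the cell; they stay binders for the
joiner, lane (d) of the lineage HANDOFF), the Mayer step (1.90)–(1.91) producing `adm`, the other leaves of `B16Ineq197`
(`Anch194`/`Vol193` = `…B16Ineq197RelCubes`, `Count196` = `…B16Count196Packing`, `XBudget` open — with treeX = treeLen + 2 ≤
#X_j + 1 its lattice form reads (1+β)κ(M^{−d}|X_j| + 1) + lam·βκ·M^{−d}|X_j| ≤ E), and minimality of the constant 2.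
Value: the last abstract GEOMETRIC leaf of the (1.97) bookkeeping becomes a kernel theorem of the continuum model modulo
named incidences; NOT summit progress.  Cell records: GAPS.md C-b02g16-1; HOME/HANDOFF.md (b02 lineage, gen 16).  Naming:
`B16Ineq197.Consts` ∕ `B16Ineq197.Polymer` written QUALIFIED (cf. `B16Ineq197` header note N1).  Imports `…B16Ineq197` +
`…B14RelTreeLength` + `…B16MergeGeometry`; modifies nothing.
-/

namespace Literature.MathematicalPhysics.QuantumFieldTheory.Balaban1983to89.B16Ineq197RelGlue

noncomputable section

open Literature.MathematicalPhysics.QuantumFieldTheory.Balaban1983to89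
open Literature.MathematicalPhysics.QuantumFieldTheory.Balaban1983to89.B13ScaleTransfer
open Literature.MathematicalPhysics.QuantumFieldTheory.Balaban1983to89.TreeLength
open Literature.MathematicalPhysics.QuantumFieldTheory.Balaban1983to89.B14.RelTreeLength
open Literature.MathematicalPhysics.QuantumFieldTheory.Balaban1983to89.B16MergeGeometry (Touch touchGraph touchGraph_adj)
open Literature.MathematicalPhysics.QuantumFieldTheory.Balaban1983to89.Step.Budget (GConn)
open Literature.Probability.LatticeModels (IsRConnected)

variable {d : ℕ}

/-! ## §1. Relative joins: through a common met cube (+1) and through a touching pair of met cubes (+2) -/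

/-- b01's CORNER ADJACENCY `CAdj` (distinct indices at sup-distance ≤ 1, `B14.RelTreeLength`) implies the lineage's `Touch`
(indices differ by ≤ 1 in every coordinate, `B16MergeGeometry`; the closed unit cubes meet). [folklore] -/
theorem touch_of_cadj {a c : Pt d} (h : CAdj a c) : Touch a c := fun μ => by
  obtain ⟨h1, h2⟩ := B13ScaleTransfer.mem_block.1 h.2 μ
  exact ⟨by omega, h2⟩

/-- `Touch a c ↔ a = c ∨ CAdj a c`: touching cubes are equal or corner-adjacent. [folklore] -/
theorem touch_iff_eq_or_cadj {a c : Pt d} : Touch a c ↔ a = c ∨ CAdj a c := by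
  constructor
  · intro h
    by_cases hac : a = c
    · exact Or.inl hac
    · exact Or.inr ⟨hac, B13ScaleTransfer.mem_block.2 fun μ => ⟨by have := (h μ).1; omega, (h μ).2⟩⟩
  · rintro (rfl | h)
    · exact Touch.refl a
    · exact touch_of_cadj h

/-- RELATIVE JOIN THROUGH A COMMON MET CUBE: relatively admissible graphs for (A, S_A) and (B, S_B) both meeting the cube c
of B ∪ A glue to a relatively admissible graph for (B ∪ A, S_B ∪ S_A) at cost ≤ 1 (one segment inside the cube c; sup
metric).  pv22's `TreeLength.admissible_join_common` is the case S = X. [cite: Balaban1989LargeFieldII, (1.93) p.388] -/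
theorem rAdmissible_join_common {A B SA SB : Finset (Pt d)} {TA TB : List (Seg d)} (hA : RAdmissible A SA TA)
    (hB : RAdmissible B SB TB) {c : Pt d} (hc : c ∈ B ∪ A) (hcA : (carrier TA ∩ cube c).Nonempty)
    (hcB : (carrier TB ∩ cube c).Nonempty) :
    ∃ T, RAdmissible (B ∪ A) (SB ∪ SA) T ∧ len T ≤ len TB + len TA + 1 := by
  obtain ⟨p, hpT, hpc⟩ := hcA
  obtain ⟨q, hqT, hqc⟩ := hcB
  refine ⟨TB ++ ((q, p) :: TA), ⟨?_, ?_, ?_⟩, ?_⟩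
  · rw [carrier_append, carrier_cons]
    refine IsConnected.union ⟨q, hqT, Set.mem_union_left _ (left_mem_segment ℝ q p)⟩ hB.connected ?_
    exact IsConnected.union ⟨p, right_mem_segment ℝ q p, hpT⟩
      ((convex_segment q p).isConnected ⟨q, left_mem_segment ℝ q p⟩) hA.connected
  · rw [carrier_append, carrier_cons]
    refine Set.union_subset (hB.subset.trans (cubes_mono Finset.subset_union_left)) (Set.union_subset ?_
      (hA.subset.trans (cubes_mono Finset.subset_union_right)))
    exact ((convex_cube c).segment_subset hqc hpc).trans (cube_subset_cubes hc)
  · intro x hx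
    rw [carrier_append, carrier_cons]
    rcases Finset.mem_union.1 hx with hx | hx
    · obtain ⟨r, hr, hrx⟩ := hB.meets x hx
      exact ⟨r, Set.mem_union_left _ hr, hrx⟩
    · obtain ⟨r, hr, hrx⟩ := hA.meets x hx
      exact ⟨r, Set.mem_union_right _ (Set.mem_union_right _ hr), hrx⟩
  · rw [len_append, len_cons]
    change len TB + (dist q p + len TA) ≤ len TB + len TA + 1
    linarith [dist_le_one_of_mem_cube hqc hpc]

/-- RELATIVE JOIN THROUGH A TOUCHING PAIR: relatively admissible graphs for (A, S_A) meeting the cube a and for (B, S_B)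
meeting the cube c, with a, c cubes of B ∪ A that TOUCH (the closed cubes meet: `B16MergeGeometry.Touch`, a common point w by
`Touch.exists_point`), glue to a relatively admissible graph for (B ∪ A, S_B ∪ S_A) at cost ≤ 2 (a segment inside cube c to
w, a segment inside cube a from w; sup metric).  The relative form of the lineage's `B16MergeGeometry.admissible_join_touch`;
print: junction cost 2d. [cite: Balaban1989LargeFieldII, (1.93) p.388] -/
theorem rAdmissible_join_touch {A B SA SB : Finset (Pt d)} {TA TB : List (Seg d)} (hA : RAdmissible A SA TA)
    (hB : RAdmissible B SB TB) {a c : Pt d} (ha : a ∈ B ∪ A) (hc : c ∈ B ∪ A) (hac : Touch a c)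
    (haA : (carrier TA ∩ cube a).Nonempty) (hcB : (carrier TB ∩ cube c).Nonempty) :
    ∃ T, RAdmissible (B ∪ A) (SB ∪ SA) T ∧ len T ≤ len TB + len TA + 2 := by
  obtain ⟨p, hpT, hpa⟩ := haA
  obtain ⟨q, hqT, hqc⟩ := hcB
  obtain ⟨w, hwa, hwc⟩ := hac.exists_point
  refine ⟨TB ++ ((q, w) :: (w, p) :: TA), ⟨?_, ?_, ?_⟩, ?_⟩
  · rw [carrier_append, carrier_cons, carrier_cons]
    have h3 : IsConnected (segment ℝ w p ∪ carrier TA) :=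
      IsConnected.union ⟨p, right_mem_segment ℝ w p, hpT⟩
        ((convex_segment w p).isConnected ⟨w, left_mem_segment ℝ w p⟩) hA.connected
    have h2 : IsConnected (segment ℝ q w ∪ (segment ℝ w p ∪ carrier TA)) :=
      IsConnected.union ⟨w, right_mem_segment ℝ q w, Set.mem_union_left _ (left_mem_segment ℝ w p)⟩
        ((convex_segment q w).isConnected ⟨q, left_mem_segment ℝ q w⟩) h3
    exact IsConnected.union ⟨q, hqT, Set.mem_union_left _ (left_mem_segment ℝ q w)⟩ hB.connected h2
  · rw [carrier_append, carrier_cons, carrier_cons]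
    refine Set.union_subset (hB.subset.trans (cubes_mono Finset.subset_union_left))
      (Set.union_subset ?_ (Set.union_subset ?_ (hA.subset.trans (cubes_mono Finset.subset_union_right))))
    · exact ((convex_cube c).segment_subset hqc hwc).trans (cube_subset_cubes hc)
    · exact ((convex_cube a).segment_subset hwa hpa).trans (cube_subset_cubes ha)
  · intro x hx
    rw [carrier_append, carrier_cons, carrier_cons]
    rcases Finset.mem_union.1 hx with hx | hx
    · obtain ⟨r, hr, hrx⟩ := hB.meets x hx
      exact ⟨r, Set.mem_union_left _ hr, hrx⟩
    · obtain ⟨r, hr, hrx⟩ := hA.meets x hx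
      exact ⟨r, Set.mem_union_right _ (Set.mem_union_right _ (Set.mem_union_right _ hr)), hrx⟩
  · rw [len_append, len_cons, len_cons]
    change len TB + (dist q w + (dist w p + len TA)) ≤ len TB + len TA + 2
    linarith [dist_le_one_of_mem_cube hqc hwc, dist_le_one_of_mem_cube hwa hpa]

/-- The join through a CORNER-ADJACENT pair of met cubes (b01's `CAdj`), cost ≤ 2. [cite: Balaban1989LargeFieldII, (1.93) p.388] -/
theorem rAdmissible_join_cadj {A B SA SB : Finset (Pt d)} {TA TB : List (Seg d)} (hA : RAdmissible A SA TA)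
    (hB : RAdmissible B SB TB) {a c : Pt d} (ha : a ∈ B ∪ A) (hc : c ∈ B ∪ A) (hac : CAdj a c)
    (haA : (carrier TA ∩ cube a).Nonempty) (hcB : (carrier TB ∩ cube c).Nonempty) :
    ∃ T, RAdmissible (B ∪ A) (SB ∪ SA) T ∧ len T ≤ len TB + len TA + 2 :=
  rAdmissible_join_touch hA hB ha hc (touch_of_cadj hac) haA hcB

/-! ## §2. The contact structure of a family of members and the gluing induction -/

variable {ι : Type*}

/-- CONTACT of two members i, j of a family with required cube families `S i`, `S j`: a required cube of i touches a
required cube of j — the typed form of *"in the cases they intersect outside Z′"* (both graphs are required to pass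
there). [cite: Balaban1989LargeFieldII, (1.93) p.388] -/
def Contact (S : ι → Finset (Pt d)) (i j : ι) : Prop := ∃ a ∈ S i, ∃ c ∈ S j, Touch a c

/-- `Contact` is symmetric. [folklore] -/
theorem Contact.symm {S : ι → Finset (Pt d)} {i j : ι} (h : Contact S i j) : Contact S j i := by
  obtain ⟨a, ha, c, hc, hac⟩ := h
  exact ⟨c, hc, a, ha, hac.symm⟩

/-- Adjacency in the lineage's TOUCH GRAPH `B16MergeGeometry.touchGraph S` (p. 386: *"a pair of domains is a line in G if …
the corresponding domains intersect, or touch each other"*) is contact of distinct members. [folklore] -/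
theorem touchGraph_adj_iff_contact (S : ι → Finset (Pt d)) (i j : ι) :
    (touchGraph S).Adj i j ↔ i ≠ j ∧ Contact S i j :=
  touchGraph_adj S i j

/-- THE CUT CONDITION of the contact structure on the index family I (= connectivity of the contact graph): every
non-empty proper subfamily G ⊊ I has a member in contact with a member of I outside G.  This is the NAMED HYPOTHESIS under
which the members' graphs glue; the typed form of *"the connected localization domain they determine is equal to X′"*
(cell GAPS C-adv6-51 (1)–(3)). [cite: Balaban1989LargeFieldII, (1.91) p.388] -/
def CutLinked (I : Finset ι) (S : ι → Finset (Pt d)) : Prop :=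
  ∀ G : Finset ι, G ⊆ I → G.Nonempty → G ≠ I → ∃ i ∈ G, ∃ j ∈ I, j ∉ G ∧ Contact S i j

/-- CHAINS GIVE THE CUT CONDITION: if every two members of I are joined by a chain of contacts inside I, then every
non-empty proper subfamily has an exit contact (first exit of a chain from inside to outside). [folklore] -/
theorem cutLinked_of_chain {I : Finset ι} {S : ι → Finset (Pt d)}
    (h : ∀ i ∈ I, ∀ j ∈ I, Relation.ReflTransGen (fun x y => Contact S x y ∧ x ∈ I ∧ y ∈ I) i j) :
    CutLinked I S := by
  intro G hGI hGne hGI'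
  obtain ⟨i₀, hi₀⟩ := hGne
  have hex : ∃ j₀ ∈ I, j₀ ∉ G := by
    by_contra hcon
    push Not at hcon
    exact hGI' (Finset.Subset.antisymm hGI hcon)
  obtain ⟨j₀, hj₀I, hj₀G⟩ := hex
  have key : ∀ z, Relation.ReflTransGen (fun x y => Contact S x y ∧ x ∈ I ∧ y ∈ I) i₀ z →
      z ∈ G ∨ ∃ i ∈ G, ∃ j ∈ I, j ∉ G ∧ Contact S i j := by
    intro z hz
    induction hz with
    | refl => exact Or.inl hi₀
    | @tail b c _ hbc ih =>
      rcases ih with hb | hfr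
      · by_cases hcG : c ∈ G
        · exact Or.inl hcG
        · exact Or.inr ⟨b, hb, c, hbc.2.2, hcG, hbc.1⟩
      · exact Or.inr hfr
  rcases key j₀ (h i₀ (hGI hi₀) j₀ hj₀I) with h' | h'
  · exact absurd h' hj₀G
  · exact h'

/-- The cut condition from `IsRConnected (Contact S) I` (the cell's standard connectivity predicate,
`Literature.Probability.LatticeModels.IsRConnected`). [folklore] -/
theorem cutLinked_of_isRConnected {I : Finset ι} {S : ι → Finset (Pt d)} (h : IsRConnected (Contact S) I) :
    CutLinked I S :=
  cutLinked_of_chain h.2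

/-- The cut condition from CONNECTIVITY OF THE TOUCH GRAPH induced on I — the cell's typed *"the graph G is connected"*
(`Step.Budget.GConn (touchGraph S) I`, modules `…Step` / `…B16MergeGeometry`): a walk from a member of G to a member outside
G has a boundary edge (`SimpleGraph.Walk.exists_boundary_dart`). [folklore] -/
theorem cutLinked_of_gconn {I : Finset ι} {S : ι → Finset (Pt d)} (h : GConn (touchGraph S) I) : CutLinked I S := by
  intro G hGI hGne hGI'
  obtain ⟨i₀, hi₀⟩ := hGne
  have hex : ∃ j₀ ∈ I, j₀ ∉ G := by
    by_contra hcon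
    push Not at hcon
    exact hGI' (Finset.Subset.antisymm hGI hcon)
  obtain ⟨j₀, hj₀I, hj₀G⟩ := hex
  obtain ⟨p⟩ := h.preconnected ⟨i₀, Finset.mem_coe.2 (hGI hi₀)⟩ ⟨j₀, Finset.mem_coe.2 hj₀I⟩
  obtain ⟨e, -, he₁, he₂⟩ := p.exists_boundary_dart {x | x.1 ∈ G} hi₀ hj₀G
  have hadj := (touchGraph_adj S _ _).1 (SimpleGraph.induce_adj.1 e.adj)
  exact ⟨e.fst.1, he₁, e.snd.1, Finset.mem_coe.1 e.snd.2, he₂, hadj.2⟩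

/-- The cut condition when every two distinct members are in contact. [folklore] -/
theorem cutLinked_of_pairwise {I : Finset ι} {S : ι → Finset (Pt d)}
    (h : ∀ i ∈ I, ∀ j ∈ I, i ≠ j → Contact S i j) : CutLinked I S := by
  intro G hGI hGne hGI'
  obtain ⟨i, hi⟩ := hGne
  have hex : ∃ j ∈ I, j ∉ G := by
    by_contra hcon
    push Not at hcon
    exact hGI' (Finset.Subset.antisymm hGI hcon)
  obtain ⟨j, hjI, hjG⟩ := hex
  exact ⟨i, hi, j, hjI, hjG, h i (hGI hi) j hjI fun e => hjG (e ▸ hi)⟩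

/-- GLUING INDUCTION (the relative form of pv22's `TreeLength.exists_admissible_glue`): given relatively admissible graphs
`f i` for the members (D i, S i), S i ⊆ D i, of a family I satisfying the cut condition, and a glued graph for a non-empty
subfamily G at cost Σ_{i∈G} len(f i) + 2(#G − 1), the whole family glues at cost Σ_{i∈I} len(f i) + 2(#I − 1): the cut
condition supplies a member j ∉ G with a required cube touching a required cube of the glued part, and
`rAdmissible_join_touch` adjoins it at cost ≤ 2. [cite: Balaban1989LargeFieldII, (1.93) p.388] -/
theorem exists_rAdmissible_glue [DecidableEq ι] {I : Finset ι} {D S : ι → Finset (Pt d)} (hSD : ∀ i ∈ I, S i ⊆ D i)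
    {f : ι → List (Seg d)} (hf : ∀ i ∈ I, RAdmissible (D i) (S i) (f i)) (hcut : CutLinked I S) :
    ∀ n : ℕ, ∀ G : Finset ι, G ⊆ I → G.Nonempty → (I \ G).card = n →
      (∃ T, RAdmissible (G.biUnion D) (G.biUnion S) T ∧ len T ≤ ∑ i ∈ G, len (f i) + 2 * ((G.card : ℝ) - 1)) →
      ∃ T, RAdmissible (I.biUnion D) (I.biUnion S) T ∧ len T ≤ ∑ i ∈ I, len (f i) + 2 * ((I.card : ℝ) - 1) := by
  intro n
  induction n with
  | zero =>
    intro G hGI _ hcard hT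
    have hGeq : G = I :=
      Finset.Subset.antisymm hGI (Finset.sdiff_eq_empty_iff_subset.1 (Finset.card_eq_zero.1 hcard))
    subst hGeq
    exact hT
  | succ n ih =>
    intro G hGI hGne hcard hT
    obtain ⟨T, hT, hlen⟩ := hT
    have hGneI : G ≠ I := by
      intro hGI'
      rw [hGI', Finset.sdiff_self, Finset.card_empty] at hcard
      exact Nat.succ_ne_zero n hcard.symm
    obtain ⟨i, hiG, j, hjI, hjG, a, haS, c, hcS, hac⟩ := hcut G hGI hGne hGneI
    have haU : a ∈ G.biUnion S := Finset.mem_biUnion.2 ⟨i, hiG, haS⟩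
    have haD : a ∈ D j ∪ G.biUnion D :=
      Finset.mem_union_right _ (Finset.mem_biUnion.2 ⟨i, hiG, hSD i (hGI hiG) haS⟩)
    have hcD : c ∈ D j ∪ G.biUnion D := Finset.mem_union_left _ (hSD j hjI hcS)
    obtain ⟨T₁, hT₁, hlen₁⟩ :=
      rAdmissible_join_touch hT (hf j hjI) haD hcD hac (hT.meets a haU) ((hf j hjI).meets c hcS)
    have hsub : insert j G ⊆ I := Finset.insert_subset hjI hGI
    have hcard' : (I \ insert j G).card = n := by
      rw [Finset.sdiff_insert, Finset.card_erase_of_mem (Finset.mem_sdiff.2 ⟨hjI, hjG⟩), hcard]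
      simp
    refine ih (insert j G) hsub (Finset.insert_nonempty _ _) hcard' ⟨T₁, ?_, ?_⟩
    · rw [Finset.biUnion_insert, Finset.biUnion_insert]
      exact hT₁
    · rw [Finset.sum_insert hjG, Finset.card_insert_of_notMem hjG]
      push_cast
      linarith

/-- GLUED GRAPH OF A FAMILY: relatively admissible graphs `f i` of the members of a non-empty family I with the cut
condition glue to a relatively admissible graph for (⋃_{i∈I} D i, ⋃_{i∈I} S i) of length ≤ Σ_{i∈I} len(f i) + 2(#I − 1).
[cite: Balaban1989LargeFieldII, (1.93) p.388] -/
theorem exists_rAdmissible_biUnion {I : Finset ι} (hI : I.Nonempty) {D S : ι → Finset (Pt d)}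
    (hSD : ∀ i ∈ I, S i ⊆ D i) {f : ι → List (Seg d)} (hf : ∀ i ∈ I, RAdmissible (D i) (S i) (f i))
    (hcut : CutLinked I S) :
    ∃ T, RAdmissible (I.biUnion D) (I.biUnion S) T ∧ len T ≤ ∑ i ∈ I, len (f i) + 2 * ((I.card : ℝ) - 1) := by
  classical
  obtain ⟨i₁, hi₁⟩ := hI
  refine exists_rAdmissible_glue hSD hf hcut _ {i₁} (Finset.singleton_subset_iff.2 hi₁) (Finset.singleton_nonempty _)
    rfl ⟨f i₁, ?_, ?_⟩
  · rw [Finset.singleton_biUnion, Finset.singleton_biUnion]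
    exact hf i₁ hi₁
  · simp

/-- The glued class is non-empty as soon as every member's class is. [folklore] -/
theorem exists_rAdmissible_biUnion_of_exists {I : Finset ι} (hI : I.Nonempty) {D S : ι → Finset (Pt d)}
    (hSD : ∀ i ∈ I, S i ⊆ D i) (hne : ∀ i ∈ I, ∃ T, RAdmissible (D i) (S i) T) (hcut : CutLinked I S) :
    ∃ T, RAdmissible (I.biUnion D) (I.biUnion S) T := by
  choose! f hf using hne
  obtain ⟨T, hT, -⟩ := exists_rAdmissible_biUnion hI hSD hf hcut
  exact ⟨T, hT⟩

/-! ## §3. Passage to infima: the relative (2.27) -/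

/-- Near-optimal relatively admissible graphs: for every ε > 0 there is one of length < d_{k,Z}(Y) + ε. [folklore] -/
theorem exists_rAdmissible_len_lt {X S : Finset (Pt d)} (hne : ∃ T, RAdmissible X S T) {ε : ℝ} (hε : 0 < ε) :
    ∃ T, RAdmissible X S T ∧ len T < relTreeLen X S + ε := by
  obtain ⟨T₀, hT₀⟩ := hne
  obtain ⟨ℓ, ⟨T, hT, rfl⟩, hlt⟩ :=
    exists_lt_of_csInf_lt (s := rlengths X S) ⟨len T₀, T₀, hT₀, rfl⟩ (lt_add_of_pos_right _ hε)
  exact ⟨T, hT, hlt⟩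

/-- MONOTONICITY of the relative size: enlarging the domain and shrinking the required family can only decrease the infimum
(every graph relatively admissible for (X, S) is so for (X′, S′) when X ⊆ X′, S′ ⊆ S), provided the class of (X, S) is
non-empty. [cite: Balaban1989LargeFieldII, (1.67) p.376] -/
theorem relTreeLen_anti {X X' S S' : Finset (Pt d)} (hX : X ⊆ X') (hS : S' ⊆ S) (hne : ∃ T, RAdmissible X S T) :
    relTreeLen X' S' ≤ relTreeLen X S := by
  obtain ⟨T, hT⟩ := hne
  refine csInf_le_csInf (bddBelow_rlengths X' S') ⟨len T, T, hT, rfl⟩ ?_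
  rintro _ ⟨T', hT', rfl⟩
  exact ⟨T', ⟨hT'.connected, hT'.subset.trans (cubes_mono hX), fun s hs => hT'.meets s (hS hs)⟩, rfl⟩

/-- With no required cube the relative size vanishes (a one-point graph, or the junk value of an empty class). [folklore] -/
theorem relTreeLen_empty (X : Finset (Pt d)) : relTreeLen X ∅ = 0 := by
  refine le_antisymm ?_ (relTreeLen_nonneg X ∅)
  rcases X.eq_empty_or_nonempty with rfl | ⟨x, hx⟩
  · have h : rlengths (∅ : Finset (Pt d)) ∅ = ∅ := by
      ext ℓ
      simp only [rlengths, Set.mem_setOf_eq, Set.mem_empty_iff_false, iff_false]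
      rintro ⟨T, hT, -⟩
      obtain ⟨p, hp⟩ := hT.connected.nonempty
      obtain ⟨y, hy, -⟩ := mem_cubes.1 (hT.subset hp)
      simp at hy
    rw [relTreeLen, h, Real.sInf_empty]
  · have hA := admissible_singleton x
    have hT : RAdmissible X ∅ [(corner x, corner x)] :=
      ⟨hA.connected, hA.subset.trans (cubes_mono (Finset.singleton_subset_iff.2 hx)),
        fun s hs => absurd hs (Finset.notMem_empty s)⟩
    have h := relTreeLen_le_len hT
    simpa using h

/-- **THE RELATIVE (2.27)**: for a non-empty family of members (D i, S i), S i ⊆ D i, each with a non-empty class, whose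
contact structure satisfies the cut condition, `relTreeLen (⋃ D i) (⋃ S i) + 2 ≤ Σ_i (relTreeLen (D i) (S i) + 2)` (glue
ε-near-optimal graphs of the members, `exists_rAdmissible_biUnion`, and let ε → 0).  pv22's `treeLen_biUnion_add_two_le`
is the case S i = D i with face-connected union. [cite: Balaban1989LargeFieldII, (1.93) p.388] -/
theorem relTreeLen_biUnion_add_two_le {I : Finset ι} (hI : I.Nonempty) {D S : ι → Finset (Pt d)}
    (hSD : ∀ i ∈ I, S i ⊆ D i) (hne : ∀ i ∈ I, ∃ T, RAdmissible (D i) (S i) T) (hcut : CutLinked I S) :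
    relTreeLen (I.biUnion D) (I.biUnion S) + 2 ≤ ∑ i ∈ I, (relTreeLen (D i) (S i) + 2) := by
  refine le_of_forall_pos_le_add fun ε hε => ?_
  have hIpos : (0 : ℝ) < I.card := by exact_mod_cast Finset.card_pos.2 hI
  obtain ⟨δ, hδpos, hδ⟩ : ∃ δ : ℝ, 0 < δ ∧ (I.card : ℝ) * δ = ε :=
    ⟨ε / I.card, div_pos hε hIpos, by field_simp⟩
  have hch : ∀ i ∈ I, ∃ T, RAdmissible (D i) (S i) T ∧ len T < relTreeLen (D i) (S i) + δ :=
    fun i hi => exists_rAdmissible_len_lt (hne i hi) hδpos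
  choose! f hf hflen using hch
  obtain ⟨T, hT, hlen⟩ := exists_rAdmissible_biUnion hI hSD hf hcut
  have h1 := relTreeLen_le_len hT
  have h2 : ∑ i ∈ I, len (f i) ≤ ∑ i ∈ I, (relTreeLen (D i) (S i) + δ) :=
    Finset.sum_le_sum fun i hi => (hflen i hi).le
  rw [Finset.sum_add_distrib, Finset.sum_const, nsmul_eq_mul] at h2
  rw [Finset.sum_add_distrib, Finset.sum_const, nsmul_eq_mul]
  linarith

/-! ## §4. The instance behind (1.93): members {X_j}_{j∈S} ⊔ 𝐃, and the leaf `Subadd193` -/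

/-- **THE GLUING BEHIND (1.93), sharp form.** For one admissible pair (S, 𝐃) of a polymer X′ with S ∪ 𝐃 ≠ ∅: the class-1
components `comp j` ⊆ X′ (j ∈ S) carry admissible graphs (all their cubes required), the domains `dom Y` ⊆ X′ (Y ∈ 𝐃) carry
graphs required on the cubes of `dom Y ∖ Z` ((1.67)); if the cubes of X′ outside U are covered by these required families
(`hcover`) and the contact structure on S ⊔ 𝐃 satisfies the cut condition (`hcut`), then `relTreeLen X′ (X′∖U) + 2 ≤
Σ_{Y∈𝐃} (relTreeLen (dom Y) (dom Y∖Z) + 2) + Σ_{j∈S} (treeLen (comp j) + 2)`. [cite: Balaban1989LargeFieldII, (1.93) p.388] -/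
theorem relTreeLen_le_glued193 {LF DomY : Type*} (comp : LF → Finset (Pt d)) (dom : DomY → Finset (Pt d))
    (X' U Z : Finset (Pt d)) (S : Finset LF) (D : Finset DomY) (hI : S.Nonempty ∨ D.Nonempty)
    (hcomp : ∀ j ∈ S, comp j ⊆ X' ∧ ∃ T, Admissible (comp j) T)
    (hdom : ∀ Y ∈ D, dom Y ⊆ X' ∧ ∃ T, RAdmissible (dom Y) (dom Y \ Z) T)
    (hcover : X' \ U ⊆ S.biUnion comp ∪ D.biUnion (fun Y => dom Y \ Z))
    (hcut : CutLinked (S.disjSum D) (Sum.elim comp (fun Y => dom Y \ Z))) :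
    relTreeLen X' (X' \ U) + 2 ≤
      ∑ Y ∈ D, (relTreeLen (dom Y) (dom Y \ Z) + 2) + ∑ j ∈ S, (treeLen (comp j) + 2) := by
  have hIne : (S.disjSum D).Nonempty := by
    rcases hI with ⟨j, hj⟩ | ⟨Y, hY⟩
    · exact ⟨Sum.inl j, Finset.inl_mem_disjSum.2 hj⟩
    · exact ⟨Sum.inr Y, Finset.inr_mem_disjSum.2 hY⟩
  have hSD : ∀ i ∈ S.disjSum D, Sum.elim comp (fun Y => dom Y \ Z) i ⊆ Sum.elim comp dom i := by
    rintro (j | Y) _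
    · exact Finset.Subset.refl _
    · exact Finset.sdiff_subset
  have hne : ∀ i ∈ S.disjSum D, ∃ T, RAdmissible (Sum.elim comp dom i) (Sum.elim comp (fun Y => dom Y \ Z) i) T := by
    rintro (j | Y) hi
    · obtain ⟨T, hT⟩ := (hcomp j (Finset.inl_mem_disjSum.1 hi)).2
      exact ⟨T, rAdmissible_self_iff.2 hT⟩
    · exact (hdom Y (Finset.inr_mem_disjSum.1 hi)).2
  have hglue := relTreeLen_biUnion_add_two_le hIne hSD hne hcut
  rw [Finset.sum_disjSum] at hglue
  simp only [Sum.elim_inl, Sum.elim_inr, relTreeLen_self] at hglue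
  have hmono : relTreeLen X' (X' \ U) ≤
      relTreeLen ((S.disjSum D).biUnion (Sum.elim comp dom))
        ((S.disjSum D).biUnion (Sum.elim comp (fun Y => dom Y \ Z))) := by
    refine relTreeLen_anti ?_ ?_ (exists_rAdmissible_biUnion_of_exists hIne hSD hne hcut)
    · intro c hc
      obtain ⟨i, hi, hci⟩ := Finset.mem_biUnion.1 hc
      rcases i with j | Y
      · exact (hcomp j (Finset.inl_mem_disjSum.1 hi)).1 hci
      · exact (hdom Y (Finset.inr_mem_disjSum.1 hi)).1 hci
    · intro c hc
      rcases Finset.mem_union.1 (hcover hc) with h | h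
      · obtain ⟨j, hj, hcj⟩ := Finset.mem_biUnion.1 h
        exact Finset.mem_biUnion.2 ⟨Sum.inl j, Finset.inl_mem_disjSum.2 hj, hcj⟩
      · obtain ⟨Y, hY, hcY⟩ := Finset.mem_biUnion.1 h
        exact Finset.mem_biUnion.2 ⟨Sum.inr Y, Finset.inr_mem_disjSum.2 hY, hcY⟩
  linarith

/-- **THE LEAF `Subadd193` OF `B16Ineq197`, DISCHARGED in the continuum model.**  For a polymer P of the cell's (1.91) ⇒
(1.97) bookkeeping whose sizes are read off the model as inequalities — `dX ≤ relTreeLen X′ (X′∖U)` (d_{k,∪Y_i}(X′)),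
`relTreeLen (dom Y) (dom Y∖Z) ≤ dY Y` (d_{k,Z}(Y), (1.67)), `treeLen (comp j) + 2 ≤ treeX j` (tree cost of X_j with its entry
connector), junction cost `2 ≤ cJ` (print: 2d) — and whose admissible pairs (S, 𝐃) satisfy the cover and cut incidences of
`relTreeLen_le_glued193`: `∀ (S,𝐃) ∈ adm, dX ≤ Σ_{Y∈𝐃}(dY Y + cJ) + Σ_{j∈S} treeX j`, i.e. `P.Subadd193 K`.  The incidence
hypotheses are the cell's READING of pp. 377/387/388 (GAPS C-adv6-51 (1)–(3), C-adv7-85 (a)), quoted in the module header,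
NOT asserted. [cite: Balaban1989LargeFieldII, (1.93) p.388] -/
theorem subadd193_of_relGlue {LF DomY : Type*} (P : B16Ineq197.Polymer LF DomY) (K : B16Ineq197.Consts)
    (comp : LF → Finset (Pt d)) (dom : DomY → Finset (Pt d)) (X' U Z : Finset (Pt d))
    (hdX : P.dX ≤ relTreeLen X' (X' \ U))
    (hdY : ∀ Y ∈ P.Ycat, relTreeLen (dom Y) (dom Y \ Z) ≤ P.dY Y)
    (htreeX : ∀ j ∈ P.cand, treeLen (comp j) + 2 ≤ P.treeX j) (hcJ : 2 ≤ K.cJ)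
    (hcomp : ∀ j ∈ P.cand, comp j ⊆ X' ∧ ∃ T, Admissible (comp j) T)
    (hdom : ∀ Y ∈ P.Ycat, dom Y ⊆ X' ∧ ∃ T, RAdmissible (dom Y) (dom Y \ Z) T)
    (hcover : ∀ p ∈ P.adm, X' \ U ⊆ p.1.biUnion comp ∪ p.2.biUnion (fun Y => dom Y \ Z))
    (hcut : ∀ p ∈ P.adm, CutLinked (p.1.disjSum p.2) (Sum.elim comp (fun Y => dom Y \ Z))) :
    P.Subadd193 K := by
  intro p hp
  have hS := P.adm_fst p hp
  have hD := P.adm_snd p hp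
  by_cases hI : p.1.Nonempty ∨ p.2.Nonempty
  · have h := relTreeLen_le_glued193 comp dom X' U Z p.1 p.2 hI (fun j hj => hcomp j (hS hj))
      (fun Y hY => hdom Y (hD hY)) (hcover p hp) (hcut p hp)
    have h1 : ∑ Y ∈ p.2, (relTreeLen (dom Y) (dom Y \ Z) + 2) ≤ ∑ Y ∈ p.2, (P.dY Y + K.cJ) :=
      Finset.sum_le_sum fun Y hY => add_le_add (hdY Y (hD hY)) hcJ
    have h2 : ∑ j ∈ p.1, (treeLen (comp j) + 2) ≤ ∑ j ∈ p.1, P.treeX j :=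
      Finset.sum_le_sum fun j hj => htreeX j (hS hj)
    linarith
  · obtain ⟨h1, h2⟩ := not_or.1 hI
    rw [Finset.not_nonempty_iff_eq_empty] at h1 h2
    have hXU : X' \ U = ∅ :=
      Finset.subset_empty.1 fun c hc => by simpa [h1, h2] using hcover p hp hc
    rw [hXU, relTreeLen_empty] at hdX
    rw [h1, h2, Finset.sum_empty, Finset.sum_empty]
    linarith

/-- The lane-(c) helper for `XBudget`: with `treeX j = treeLen (comp j) + 2` the tree cost of a (non-empty, face-connected)
class-1 component is at most its cube count plus one (pv22's `treeLen_le_card_sub_one`: a localization domain has an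
admissible graph of length ≤ #cubes − 1; print: *"exp((1 + β + (3·2^d)⁻¹β)κM^{−d}|X_{j_h}|)"*). [cite: Balaban1989LargeFieldII, (1.93) p.388] -/
theorem treeLen_add_two_le_card_add_one {X : Finset (Pt d)} (hX : X.Nonempty) (hc : FaceConnected X) :
    treeLen X + 2 ≤ (X.card : ℝ) + 1 := by
  have h := treeLen_le_card_sub_one hX hc
  linarith

/-- **WINDOW COROLLARY** on unit b01's concrete carrier `B14.RelTreeLength.Window d` (cubes of a window B ⊆ ℤ^d, large-field
region `W.Z`, domains `W.relSys.Dom` = pv22's `Dom W.B`, relative size `W.relSys.dRel Y = relTreeLen Y (Y∖Z)` BY NAME): for a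
polymer over these domains with `dY = dRel` on the catalogue, the Y-graphs exist by b01's `exists_rAdmissible`, and
`Subadd193` follows from the cover and cut incidences alone. [cite: Balaban1989LargeFieldII, (1.93) p.388] -/
theorem subadd193_window (W : Window d) {LF : Type*} (P : B16Ineq197.Polymer LF W.relSys.Dom) (K : B16Ineq197.Consts)
    (comp : LF → Finset (Pt d)) (X' U : Finset (Pt d))
    (hdX : P.dX ≤ relTreeLen X' (X' \ U)) (hdY : ∀ Y ∈ P.Ycat, P.dY Y = W.relSys.dRel Y)
    (htreeX : ∀ j ∈ P.cand, treeLen (comp j) + 2 ≤ P.treeX j) (hcJ : 2 ≤ K.cJ)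
    (hcomp : ∀ j ∈ P.cand, comp j ⊆ X' ∧ (comp j).Nonempty ∧ FaceConnected (comp j))
    (hdom : ∀ Y ∈ P.Ycat, Y.1 ⊆ X')
    (hcover : ∀ p ∈ P.adm, X' \ U ⊆ p.1.biUnion comp ∪ p.2.biUnion (fun Y => Y.1 \ W.Z))
    (hcut : ∀ p ∈ P.adm, CutLinked (p.1.disjSum p.2) (Sum.elim comp (fun Y => Y.1 \ W.Z))) :
    P.Subadd193 K :=
  subadd193_of_relGlue P K comp (fun Y => Y.1) X' U W.Z hdX
    (fun Y hY => by rw [hdY Y hY, Window.relSys_dRel]) htreeX hcJ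
    (fun j hj => ⟨(hcomp j hj).1,
      let ⟨T, hT, _⟩ := exists_admissible (hcomp j hj).2.1 (hcomp j hj).2.2; ⟨T, hT⟩⟩)
    (fun Y hY => ⟨hdom Y hY, exists_rAdmissible Y.2.2.1 Y.2.2.2 Finset.sdiff_subset⟩) hcover hcut

/-! ## §5. Non-vacuity: two corner-adjacent cubes of ℤ¹ -/

namespace Toy

/-- The cubes of ℤ¹ of index 0 (`b = false`) and 1 (`b = true`). [folklore] -/
def tpt (b : Bool) : Pt 1 := fun _ => ((b.toNat : ℕ) : ℤ)

/-- Any two toy cubes touch. [folklore] -/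
theorem tpt_touch (b b' : Bool) : Touch (tpt b) (tpt b') := fun μ => by
  cases b <;> cases b' <;> simp [tpt]

/-- The toy polymer: no class-1 candidates, the two one-cube domains as the catalogue, one admissible pair (∅, {Y₀, Y₁}),
all sizes 0. [folklore] -/
def toyP : B16Ineq197.Polymer Unit Bool where
  cand := ∅
  Ycat := Finset.univ
  adm := {(∅, Finset.univ)}
  dX := 0
  v := 0
  dY := fun _ => 0
  treeX := fun _ => 0
  vol := fun _ => 0
  adm_fst := fun p hp => by rw [Finset.mem_singleton.1 hp]
  adm_snd := fun p _ => Finset.subset_univ _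
  v_nonneg := le_rfl
  dY_nonneg := fun _ _ => le_rfl

/-- Toy constants: junction cost cJ = 2, everything else 0. [folklore] -/
def toyK : B16Ineq197.Consts where
  α := 0
  β := 0
  κ := 0
  p0 := 0
  β₀ := 0
  s := 0
  E := 0
  lam := 0
  a₁ := 0
  a₀ := 0
  cJ := 2
  C₁ := 0
  ρ := 0

/-- **Non-vacuity of `subadd193_of_relGlue`**: two Y-members `{tpt false}`, `{tpt true}` (corner-adjacent cubes of ℤ¹), no
X_j, X′ = both cubes, U = Z = ∅ — the cover holds, the cut condition holds (`cutLinked_of_pairwise`), all size clauses hold,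
and the conclusion is the toy polymer's `Subadd193`. [folklore] -/
theorem toy_subadd193 : toyP.Subadd193 toyK :=
  subadd193_of_relGlue (d := 1) toyP toyK (fun _ => ∅) (fun b => {tpt b}) {tpt false, tpt true} ∅ ∅
    (relTreeLen_nonneg _ _)
    (fun Y _ => by
      rw [Finset.sdiff_empty, relTreeLen_self, treeLen_singleton]
      exact le_rfl)
    (fun j hj => absurd hj (Finset.notMem_empty j)) (show (2 : ℝ) ≤ 2 from le_rfl)
    (fun j hj => absurd hj (Finset.notMem_empty j))
    (fun Y _ => ⟨Finset.singleton_subset_iff.2 (by cases Y <;> simp),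
      ⟨_, rAdmissible_of_admissible (admissible_singleton (tpt Y)) Finset.sdiff_subset⟩⟩)
    (fun p hp c hc => by
      rw [Finset.mem_singleton.1 hp]
      rw [Finset.sdiff_empty, Finset.mem_insert, Finset.mem_singleton] at hc
      refine Finset.mem_union_right _ (Finset.mem_biUnion.2 ?_)
      rcases hc with rfl | rfl
      · exact ⟨false, Finset.mem_univ _, by simp⟩
      · exact ⟨true, Finset.mem_univ _, by simp⟩)
    (fun p hp => by
      rw [Finset.mem_singleton.1 hp]
      refine cutLinked_of_pairwise fun i hi j hj _ => ?_
      rcases i with u | b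
      · exact absurd (Finset.inl_mem_disjSum.1 hi) (Finset.notMem_empty u)
      rcases j with u | b'
      · exact absurd (Finset.inl_mem_disjSum.1 hj) (Finset.notMem_empty u)
      exact ⟨tpt b, by simp, tpt b', by simp, tpt_touch b b'⟩)

end Toy

end

end Literature.MathematicalPhysics.QuantumFieldTheory.Balaban1983to89.B16Ineq197RelGlue
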